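import Summits.CriticalPhenomena.Ising3DConformalLimit.Theses.GaussianScaleMixture
import Summits.CriticalPhenomena.Ising3DConformalLimit.Theorems.MoebiusLimitExists.Negative.FreeReflections
import Summits.CriticalPhenomena.Ising3DConformalLimit.Theorems.MoebiusLimitExists.Negative.MeshContinuity

/-!
# Line `two-crystals-generate-so3` — checked skeleton for crux `RotationUpgradeFromTwoPoint`
# (item stmt-CriticalPhenomena-8367, route `GaussianScaleMixture`, rank 4) — LEAD'S RESHAPE (gen 2)

Crux decl (concluded BY NAME by `RotationUpgradeFromTwoPoint_of` at the end of this file):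
`Summit.CriticalPhenomena.Ising3DConformalLimit.Theses.GaussianScaleMixture.RotationUpgradeFromTwoPoint`

  ∀ ρ Δ S, (H1) ρ > 0 on (0,1] → (H2) HasPointwiseScalingLimit (criticalCorr 3) ρ S →
    (H3) S = 0 off NonCoincident → (H4) IsNondegenerateTwoPoint S → (H5) IsTranslationInvariant S →
    (H6) IsScaleCovariant Δ S → (H7) x ↦ S 2 ![0,x] is O(3)-invariant off 0 → IsRotationInvariant S.

## The line, reshaped by the lead (prover-line-stmt-CriticalPhenomena-8367-0, 2026-08-16)

TWO CRYSTALS GENERATE O(3). The stacked-triangular graph `T` on the SAME vertex set `ℤ³`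
(bonds `±e₀, ±e₁, ±e₂, ±(e₀ − e₁)`) has the exact graph automorphism
`M̃ = !![0,-1,0; 1,1,0; 0,0,1]` of order 6 fixing the origin. The universality bridge (stub 1, OPEN)
is now stated in the SYMMETRIC GAUGE: the critical `T`-ferromagnet converges, after renormalisation,
to `x ↦ S (L_c x)` where `L_c (x₀,x₁,x₂) = (x₀ + x₁/2, (√3/2)x₁, c·x₂)` is the equilateral embedding
of the layers with the stacking axis vertical and ONE free axial scale `c > 0` (the planner's form
quantified `∃ L ∈ GL(3,ℝ)`; under the crux's conclusion the two forms are equivalent — any `L` has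
`LᵀL = α·(hex ⊕ c²)` by `M̃`-invariance of the round two-point function, so `L = √α·U·L_c`, and the
rotation `U` and the scale `√α` are invisible to an `O(3)`-invariant scale-covariant `S`; the gauge
choice moves the abstract closed-subgroup lemma "`B₃` + a 60° rotation about an ARBITRARY axis +
closedness ⇒ `O(3)`" out of this line and leaves the EXPLICIT one below). Transport (stubs 2 + 3,
provable now) gives `S ∘ L_c ∘ M̃ = S ∘ L_c`, i.e. `S` is invariant under
`L_c M̃ L_c⁻¹ = R_z(60°)` EXACTLY (computed in §2; no use of H4–H7). With the free `B₃`
(tree `limit_coordPerm`, `limit_signFlip`) this gives `R_z(30°) = R_z(60°)² R_z(-90°)` and the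
explicit element `N := R_z(30°) R_x(90°) R_z(30°)`, a rotation by `θ₀ = arccos(-1/4)` about the
axis `(2,0,1)/√5` (stub 5: `N = W R_z(θ₀) W` with the explicit symmetric orthogonal frame
`W = (1/√5)!![-1,0,2; 0,-√5,0; 2,0,1]`). `θ₀/2π` is irrational (stub 4, a 2-adic valuation count
on `2cos(nθ₀)`), the invariance group of `S` is closed (continuity is FREE, tree
`continuousOn_limit`), so it contains the whole circle `W R_z(φ) W` (stub 6: closed subgroups of
`ℝ` are `ℝ` or cyclic), and its conjugate `W R_x(φ) W` by the signed permutation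
`(x,y,z) ↦ (-z,y,x)` (stub 5, second identity); two circle groups about orthogonal axes act
transitively on the sphere, one coordinate reflection is free, so EVERY reflection is an invariance
and Cartan–Dieudonné (`LinearIsometryEquiv.reflections_generate`) gives `O(3)` (stub 7).

## Registered stubs (the ONLY `sorry`s of this file)

| stub | statement | size | status |
|---|---|---|---|
| `stub_hexStackUniversality` | (U_hex) in symmetric gauge: the critical `T`-correlators converge to `S ∘ L_c` | XL | OPEN (3D universality for `(ℤ³, T)`); held by the lead |
| `stub_hexPlusStateSixfold` | plus state of any graph on `ℤ³` with the `T` bond set is exactly `M̃`-invariant on spin monomials, `β ≥ 0` | M | provable now |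
| `stub_latticeSymmetryTransport` | `GL_d(ℤ)` symmetries pass to continuous pointwise scaling limits | M | provable now |
| `stub_arccosQuarter` | `m·arccos(-1/4) ∉ 2πℤ` for `m ≠ 0` | S | provable now |
| `stub_twistIdentities` | the two explicit `3 × 3` identities `W R_z(θ₀) W = R_z(30°)R_x(90°)R_z(30°)`, `R_c W R_z(φ) W R_c⁻¹ = W R_x(φ) W` | S | provable now |
| `stub_circleClosed` | a one-parameter group of isometries meeting a closed invariance group in an irrational angle lies in it | M | provable now |
| `stub_rotationsFromTwoCircles` | two conjugate coordinate circles + one coordinate reflection ⇒ `IsRotationInvariant` (Cartan–Dieudonné) | M/L | provable now |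

Composition: `RotationUpgradeFromTwoPoint_of` (no `sorry`) — see §2.

## Disproof used (`Cruxes/RotationUpgradeFromTwoPoint/Disproof.lean` v4, cdisprove cycle 1)

* §3 `not_cruxWithoutIsingLimit` / `not_cruxWithCubicLatticeLimit`: (H2) is consumed by stub 1 (a
  joint statement about `criticalCorr 3` and the `T`-correlators) and by the free `B₃`/continuity of
  genuine limits; the cubic decoy has no `M̃`-symmetric partner.
* §1 `crux_iff_core` / `crux_iff_bare`: (H4)–(H7) are NOT used by this skeleton at all — in the
  symmetric gauge the transported sixfold map is the isometry `R_z(60°)` on the nose, so the line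
  proves the H7-free statement `LimitRotationInvariant` (crux stmt-1980 of HyperoctahedralRP) from
  the same bridge (triage k2/k3's observation, now realised).
* §1 `limit_continuousOn` (continuity is FREE) is exactly what makes the invariance group closed
  (stub 6's hypothesis), as the disprover anticipated ("lines needing a continuous limit get it for free").
* §4 `rpCubicDecoy`: not engaged (no reflection positivity anywhere on this line).
* Landed `Theorems/RotationUpgradeFromTwoPoint/Negative/*`: structural (AutomaticOrders,
  NondegeneracyRedundant, ContinuityFree) or about the non-RP decoy / dropping (H3); no stub here is
  an instance they refute.
-/

noncomputable section

open Literature.Probability.LatticeModels Finset Filter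
open Summit.CriticalPhenomena.Ising3DConformalLimit

namespace Summit.CriticalPhenomena.Ising3DConformalLimit.Cruxes.RotationUpgradeFromTwoPoint.TwoCrystalsGenerateSo3

local notation "E3" => EuclideanSpace ℝ (Fin 3)

/-! ## §0 The second crystal: the stacked-triangular Ising ferromagnet on the vertex set `ℤ³` -/

/-- The extra in-layer diagonal `e₀ − e₁ = (1,-1,0)` of the stacked-triangular lattice (the tree's
planar `triDiag = (1,-1)` of `TriangularLattice.lean`, stacked along `e₂`). [folklore] -/
def stDiag : Site 3 := ![1, -1, 0]

/-- `stDiag ≠ 0`. [folklore] -/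
theorem stDiag_ne_zero : stDiag ≠ 0 := fun h => by
  have := congrFun h 0
  simp [stDiag] at this

/-- The stacked-triangular graph `T` on the vertex set `ℤ³`: `x ∼ y` iff `x, y` are nearest
neighbours in `ℤ³` or differ by `±(1,-1,0)`; bonds `±e₀, ±e₁, ±e₂, ±(e₀−e₁)` (triangular layers
`{x₂ = const}` stacked along `e₂`). Same construction as the tree's `triGraph`. [folklore] -/
def stGraph : SimpleGraph (Site 3) :=
  SimpleGraph.fromRel fun x y => (zdGraph 3).Adj x y ∨ y = x + stDiag

/-- Adjacency in `T`, unfolded. [folklore] -/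
theorem stGraph_adj_iff (x y : Site 3) :
    stGraph.Adj x y ↔ (zdGraph 3).Adj x y ∨ y = x + stDiag ∨ x = y + stDiag := by
  simp only [stGraph, SimpleGraph.fromRel_adj, ne_eq]
  constructor
  · rintro ⟨-, (h | h) | (h | h)⟩
    · exact Or.inl h
    · exact Or.inr (Or.inl h)
    · exact Or.inl h.symm
    · exact Or.inr (Or.inr h)
  · rintro (h | h | h)
    · exact ⟨h.ne, Or.inl (Or.inl h)⟩
    · refine ⟨fun hxy => stDiag_ne_zero ?_, Or.inl (Or.inr h)⟩
      subst hxy; simpa using h.symm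
    · refine ⟨fun hxy => stDiag_ne_zero ?_, Or.inr (Or.inr h)⟩
      subst hxy; simpa using h.symm

/-- Adjacency in `T` through the bond set `{±e₀, ±e₁, ±e₂, ±(e₀ − e₁)}`: `x ∼ y` iff `y − x` is a
bond vector (the form consumed by `HexPlusStateSixfold`). [folklore] -/
theorem stGraph_adj_iff_bond (x y : Site 3) :
    stGraph.Adj x y ↔
      ((∃ i : Fin 3, y - x = Pi.single i 1 ∨ y - x = -Pi.single i 1) ∨
        y - x = ![1, -1, 0] ∨ y - x = ![-1, 1, 0]) := by
  have k1 : ∀ v : Site 3, y - x = v ↔ y = x + v := fun v => by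
    rw [sub_eq_iff_eq_add, add_comm]
  have k2 : ∀ v : Site 3, y - x = -v ↔ x = y + v := fun v => by
    rw [sub_eq_iff_eq_add]
    constructor
    · intro h; rw [h]; abel
    · intro h; rw [h]; abel
  have hneg : (![-1, 1, 0] : Site 3) = -![1, -1, 0] := by
    ext j; fin_cases j <;> simp
  rw [stGraph_adj_iff, zdGraph_adj_iff, hneg]
  simp only [k2]
  simp only [k1]
  rfl

/-- `ℤ³` is a spanning subgraph of `T` (one ferromagnetic bond family added). [folklore] -/
theorem zdGraph_le_stGraph : zdGraph 3 ≤ stGraph := fun x y h => (stGraph_adj_iff x y).2 (Or.inl h)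

instance : DecidableRel stGraph.Adj := fun x y =>
  decidable_of_iff _ (stGraph_adj_iff x y).symm

/-- `T` is locally finite (8 neighbours: the 6 of `ℤ³` and `x ± (1,-1,0)`). [folklore] -/
instance : stGraph.LocallyFinite := fun x =>
  Fintype.ofFinset
    (((zdGraph 3).neighborFinset x ∪ {x + stDiag, x - stDiag}).filter fun y => stGraph.Adj x y)
    (by
      intro y
      simp only [mem_filter, mem_union, SimpleGraph.mem_neighborFinset, mem_insert,
        mem_singleton, SimpleGraph.mem_neighborSet, and_iff_right_iff_imp]
      intro h
      obtain h | h | h := (stGraph_adj_iff x y).1 h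
      · exact Or.inl h
      · exact Or.inr (Or.inl h)
      · exact Or.inr (Or.inr (by rw [h, add_sub_cancel_right])))

/-- The plus state `⟨f⟩⁺_{T;β,0} = lim_L ⟨f⟩^+_{B(L);β,0}` of the nearest-neighbour Ising
ferromagnet (all couplings `1`, zero field) on `T`, along the cubic boxes `box 3 L` — verbatim the
tree's `plusExpect` with `zdGraph 3` replaced by `stGraph` (junk-valued if divergent; it converges on
spin monomials for `β ≥ 0` by GKS volume antitonicity). [folklore] -/
def stPlusExpect (β : ℝ) (f : SpinConfig (Site 3) → ℝ) : ℝ :=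
  limUnder atTop fun L : ℕ => isingExpect stGraph (box 3 L) β 0 .plus f

/-- The plus-state spin correlators `⟨∏ᵢ σ_{kᵢ}⟩⁺_{T;β,0}` of `T` as a `LatticeCorrFamily 3`
(repetitions allowed, as for `criticalCorr`). [folklore] -/
def stCorr (β : ℝ) : LatticeCorrFamily 3 := fun _ k => stPlusExpect β (spinMonomial k)

/-- Spontaneous magnetisation `m*_T(β) = ⟨σ₀⟩⁺_{T;β,0}` of `T`. [folklore] -/
def stMagnetization (β : ℝ) : ℝ := stPlusExpect β (spinAt 0)

/-- The critical inverse temperature `β_c(T) = inf {β ≥ 0 | m*_T(β) > 0}` of the stacked-triangular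
ferromagnet (same shape as the tree's `criticalBeta`). [folklore] -/
def stCriticalBeta : ℝ := sInf {β : ℝ | 0 ≤ β ∧ 0 < stMagnetization β}

/-- `β_c(T) ≥ 0`. [folklore] -/
theorem stCriticalBeta_nonneg : 0 ≤ stCriticalBeta := Real.sInf_nonneg fun _ hβ => hβ.1

/-- The critical correlators of the stacked-triangular ferromagnet, `⟨∏ σ_{kᵢ}⟩⁺_{T;β_c(T),0}`. [folklore] -/
def stCriticalCorr : LatticeCorrFamily 3 := stCorr stCriticalBeta

/-- The sixfold automorphism `M̃` of `T` fixing `0`: `M̃ e₀ = e₁`, `M̃ e₁ = e₁ − e₀`, `M̃ e₂ = e₂`;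
`M̃⁶ = 1`. [folklore] -/
def sixfold : Matrix (Fin 3) (Fin 3) ℤ := !![0, -1, 0; 1, 1, 0; 0, 0, 1]

/-- The inverse `M̃⁻¹ = M̃⁵ = !![1,1,0; -1,0,0; 0,0,1] ∈ GL₃(ℤ)`. [folklore] -/
def sixfoldInv : Matrix (Fin 3) (Fin 3) ℤ := !![1, 1, 0; -1, 0, 0; 0, 0, 1]

/-- `M̃ M̃⁻¹ = 1`. [folklore] -/
theorem sixfold_mul_sixfoldInv : sixfold * sixfoldInv = 1 := by decide

/-- `M̃⁻¹ M̃ = 1`. [folklore] -/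
theorem sixfoldInv_mul_sixfold : sixfoldInv * sixfold = 1 := by decide

/-- The real-linear action on `ℝ^d` of an integer matrix (`Matrix.toEuclideanLin` of its cast). [folklore] -/
abbrev zlin {d : ℕ} (M : Matrix (Fin d) (Fin d) ℤ) :
    EuclideanSpace ℝ (Fin d) →ₗ[ℝ] EuclideanSpace ℝ (Fin d) :=
  Matrix.toEuclideanLin (M.map ((↑) : ℤ → ℝ))

/-! ## §1 The seven registered stubs (the ONLY `sorry`s of this file)

Every statement except stub 1 uses tree vocabulary only, so each worker restates it verbatim in its
own `Theorems/GaussianScaleMixtureRotationUpgradeFromTwoPoint<Stub>.lean`. -/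

/-- **Registered stub `stub_hexStackUniversality`** [XL, OPEN]. **(U_hex) in symmetric gauge — the universality bridge
(OPEN, XL; the line's Transfer `C⁺`, held by the lead).** For every instance of (H1)–(H4) of the crux,
the critical plus-state correlators of the stacked-triangular ferromagnet `T` (same vertex set `ℤ³`,
one added ferromagnetic bond family `±(e₀−e₁)`, at its own `β_c(T)`; `stCriticalCorr` of §0, i.e.
`fun n k => limUnder atTop (fun L => isingExpect stGraph (box 3 L) β_c(T) 0 .plus (spinMonomial k))`)
converge, after some renormalisation `ρ' > 0`, locally uniformly on non-coincident configurations,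
to `x ↦ S n (L_c x₁, …, L_c xₙ)` where `L_c (v₀,v₁,v₂) = (v₀ + v₁/2, (√3/2)·v₁, c·v₂)` is the
equilateral embedding of the triangular layers (bond vectors `e₀, e₁, e₀−e₁ ↦` unit vectors at mutual
angles `60°`) with the stacking axis vertical and a free axial scale `c > 0` (the in-plane/axial
velocity ratio is non-universal; the overall scale is absorbed in `ρ'`). Why plausibly true: RG
irrelevance of lattice anisotropy at the 3D Ising fixed point (Cardy 1996 §3 pp. 56–57; ω_NR ≈ 2.02,
arXiv:2105.09781) together with the EXACT symmetries shared by `T` and `ℤ³` (the stacking reflection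
`x₂ ↦ −x₂`, the in-layer dihedral group), which pin the gauge; the `d = 2` analogue is a theorem
(arXiv:2012.11672 Thm 1.2/2.1). Why it might fail / cost: 3D inter-lattice universality, open, no
small parameter; `β_c(T) < β_c(3)` strictly (Aizenman–Grimmett 1991). Relation to the planner's
gauge-free form `∃ L ∈ GL(3,ℝ)`: equivalent under the conclusion of the crux (any admissible `L` has
`LᵀL = α·(hex ⊕ c²)` by `M̃`-invariance of the round two-point function, so `L = √α·U·L_c` with
`U ∈ O(3)`, invisible to an `O(3)`-invariant scale-covariant `S`). This is the ONLY stub of this file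
whose statement uses a §0 definition (`stCriticalCorr`); it is not meant to be landed by a worker. [folklore] -/
theorem stub_hexStackUniversality :
  ∀ (ρ : ℝ → ℝ) (S : CorrFamily 3), (∀ δ ∈ Set.Ioc (0:ℝ) 1, 0 < ρ δ) →
    HasPointwiseScalingLimit (criticalCorr 3) ρ S →
    (∀ n z, z ∉ NonCoincident 3 n → S n z = 0) → IsNondegenerateTwoPoint S →
    ∃ (ρ' : ℝ → ℝ) (c : ℝ), (∀ δ ∈ Set.Ioc (0:ℝ) 1, 0 < ρ' δ) ∧ 0 < c ∧
      HasPointwiseScalingLimit stCriticalCorr ρ'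
        (fun n x => S n (fun i => WithLp.toLp 2
          ![(x i) 0 + (x i) 1 / 2, Real.sqrt 3 / 2 * (x i) 1, c * (x i) 2])) := by
  sorry

/-- **Registered stub `stub_hexPlusStateSixfold`** [M]. **Exact sixfold symmetry of the second crystal (provable now,
M).** For ANY graph `G` on `ℤ³` whose adjacency is "`y − x` is one of the eight bond vectors
`±e₀, ±e₁, ±e₂, ±(e₀−e₁)`" (so `G = T`, see `stGraph_adj_iff_bond`), and every `β ≥ 0`, the box-limit
plus state is invariant under `M̃ = !![0,-1,0; 1,1,0; 0,0,1]` on spin monomials: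
`lim_L ⟨∏ σ_{M̃ kᵢ}⟩⁺_{B(L)} = lim_L ⟨∏ σ_{kᵢ}⟩⁺_{B(L)}`. Proof sketch: `M̃` permutes the bond set, hence
is a graph automorphism fixing `0` (`SimpleGraph.Iso` from the `Equiv` `k ↦ M̃ k`, inverse
`!![1,1,0; -1,0,0; 0,0,1]`); finite-volume covariance (tree `isingExpect_fixed_relabel`,
`IsingAutomorphismCovariance.lean`; `.plus = .fixed 1` and the constant configuration `1` is
relabel-invariant) gives `⟨σ_{M̃A}⟩⁺_Λ = ⟨σ_A⟩⁺_{M̃⁻¹Λ}`; `Λ ↦ ⟨σ_A⟩⁺_{Λ;β,0}` is antitone for `β ≥ 0`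
(tree `isingExpect_plus_spinMonomial_anti_volume`, any locally finite graph) and bounded below, so
along the cubic boxes AND along the sheared boxes `M̃⁻¹(box L)` (both cofinal among finite volumes:
every finite set lies in some box) the limit is the infimum over all finite volumes; in particular
both `limUnder`s are genuine limits and they agree. [folklore] -/
theorem stub_hexPlusStateSixfold :
  ∀ (G : SimpleGraph (Site 3)) [DecidableRel G.Adj] [G.LocallyFinite],
    (∀ x y : Site 3, G.Adj x y ↔
      ((∃ i : Fin 3, y - x = Pi.single i 1 ∨ y - x = -Pi.single i 1) ∨
        y - x = ![1, -1, 0] ∨ y - x = ![-1, 1, 0])) →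
    ∀ β : ℝ, 0 ≤ β → ∀ (n : ℕ) (k : Fin n → Site 3),
      limUnder atTop (fun L : ℕ => isingExpect G (box 3 L) β 0 .plus
        (spinMonomial (fun i => (!![0, -1, 0; 1, 1, 0; 0, 0, 1] : Matrix (Fin 3) (Fin 3) ℤ).mulVec (k i)))) =
      limUnder atTop (fun L : ℕ => isingExpect G (box 3 L) β 0 .plus (spinMonomial k)) := by
  sorry

/-- **Registered stub `stub_latticeSymmetryTransport`** [M]. **Lattice symmetries pass to continuous scaling limits
(provable now, M).** In any dimension `d`, for any lattice family `G` invariant under an integer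
matrix `M ∈ GL_d(ℤ)` (two-sided integer inverse `N`), every pointwise scaling limit `S` of `G` (any
renormalisation) that is continuous on `NonCoincident` is invariant under the real-linear map of `M`
on non-coincident configurations. Proof sketch (the "cell-straddling" argument of
`cubicFamily_hasPointwiseScalingLimit` / `limit_coordPerm`, now with a genuine rounding defect):
`⌊M y⌋ = M⌊y⌋ + r` with `r ∈ ℤ^d`, `|r_j| ≤ Σ_k |M_{jk}|`; by `M`-invariance
`G(M⌊xᵢ/δ⌋ + rᵢ) = G(⌊xᵢ/δ⌋ + N rᵢ) = G(⌊(xᵢ + δ N rᵢ)/δ⌋)`, i.e. the rescaled correlator at `M x`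
equals the one at the `O(δ)`-shifted configuration `x + δ N r(δ,x)`; locally uniform convergence at
`x` plus continuity of `S n` at `x` give the limit `S n x`, while the left side tends to `S n (M x)`
(`M` injective preserves `NonCoincident`). Continuity is genuinely needed (tree
`PointwiseScalingLimitNotContinuous.lean`). [folklore] -/
theorem stub_latticeSymmetryTransport :
  ∀ (d : ℕ) (G : LatticeCorrFamily d) (ρ : ℝ → ℝ) (S : CorrFamily d)
    (M N : Matrix (Fin d) (Fin d) ℤ), M * N = 1 → N * M = 1 →
    (∀ (n : ℕ) (k : Fin n → Site d), G n (fun i => M.mulVec (k i)) = G n k) →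
    HasPointwiseScalingLimit G ρ S →
    (∀ n, ContinuousOn (S n) (NonCoincident d n)) →
    ∀ (n : ℕ) (x : Fin n → EuclideanSpace ℝ (Fin d)), x ∈ NonCoincident d n →
      S n (fun i => Matrix.toEuclideanLin (M.map ((↑) : ℤ → ℝ)) (x i)) = S n x := by
  sorry

/-- **Registered stub `stub_arccosQuarter`** [S]. **`θ₀ = arccos(-1/4)` is not a rational multiple of `2π`
(provable now, S).** Equivalently the rotation by `θ₀` has infinite order. Proof sketch:
`cₙ := 2cos(nθ₀)` satisfies `c₀ = 2`, `c₁ = -1/2`, `cₙ₊₁ = c₁cₙ − cₙ₋₁`, so `cₙ = aₙ/2ⁿ` with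
`aₙ₊₁ = -aₙ − 4aₙ₋₁`, `a₁ = -1`, hence `aₙ` odd for `n ≥ 1` and `cₙ ≠ 2`; but `mθ₀ = 2πk` with
`m ≠ 0` would give `cos(|m|θ₀) = 1` (Niven-type statement). [folklore] -/
theorem stub_arccosQuarter :
  ∀ m k : ℤ, m ≠ 0 → (m : ℝ) * Real.arccos (-1 / 4) ≠ (k : ℝ) * (2 * Real.pi) := by
  sorry

/-- **Registered stub `stub_twistIdentities`** [S]. **The two explicit twist identities (provable now, S).** With the
explicit maps (all written in coordinates, `x = (x 0, x 1, x 2)`): the symmetric orthogonal frame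
`W x = ((-x₀ + 2x₂)/√5, -x₁, (2x₀ + x₂)/√5)` (`W² = 1`, `W e₂ = (2,0,1)/√5`), the rotations
`R_z(φ) x = (cos φ x₀ − sin φ x₁, sin φ x₀ + cos φ x₁, x₂)`, `R_x(φ) x = (x₀, cos φ x₁ − sin φ x₂,
sin φ x₁ + cos φ x₂)`, the special values `R_z(30°)`, `R_x(90°) x = (x₀, −x₂, x₁)`,
`R_{θ₀} = R_z(θ₀)` with `cos θ₀ = -1/4`, `sin θ₀ = √15/4`, and the signed permutation
`R_c x = (−x₂, x₁, x₀)` (inverse `x ↦ (x₂, x₁, −x₀)`):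
(1) `W (R_{θ₀} (W x)) = R_z(30°) (R_x(90°) (R_z(30°) x))` — the element `N` of the invariance group
is the rotation by `θ₀` about `(2,0,1)/√5`; (2) `R_c (W (R_z(φ) (W (R_c⁻¹ x)))) = W (R_x(φ) (W x))`
— conjugating the first circle by `R_c` gives the circle about the orthogonal axis
`W e₀ = (−1,0,2)/√5`. Nine polynomial identities in `√3, √5, √15 = √3·√5` each (checked
numerically by the lead before registration). [folklore] -/
theorem stub_twistIdentities :
  ∀ (W Rz30 Rx90 Rth Rc Rcinv : E3 → E3) (Rz Rx : ℝ → E3 → E3),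
    (∀ x, W x = WithLp.toLp 2 ![(-x 0 + 2 * x 2) / Real.sqrt 5, -x 1, (2 * x 0 + x 2) / Real.sqrt 5]) →
    (∀ x, Rz30 x = WithLp.toLp 2
      ![Real.sqrt 3 / 2 * x 0 - x 1 / 2, x 0 / 2 + Real.sqrt 3 / 2 * x 1, x 2]) →
    (∀ x, Rx90 x = WithLp.toLp 2 ![x 0, -x 2, x 1]) →
    (∀ x, Rth x = WithLp.toLp 2
      ![-(1 / 4) * x 0 - Real.sqrt 15 / 4 * x 1, Real.sqrt 15 / 4 * x 0 + -(1 / 4) * x 1, x 2]) →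
    (∀ x, Rc x = WithLp.toLp 2 ![-x 2, x 1, x 0]) →
    (∀ x, Rcinv x = WithLp.toLp 2 ![x 2, x 1, -x 0]) →
    (∀ φ x, Rz φ x = WithLp.toLp 2
      ![Real.cos φ * x 0 - Real.sin φ * x 1, Real.sin φ * x 0 + Real.cos φ * x 1, x 2]) →
    (∀ φ x, Rx φ x = WithLp.toLp 2
      ![x 0, Real.cos φ * x 1 - Real.sin φ * x 2, Real.sin φ * x 1 + Real.cos φ * x 2]) →
    (∀ x, W (Rth (W x)) = Rz30 (Rx90 (Rz30 x))) ∧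
    (∀ φ x, Rc (W (Rz φ (W (Rcinv x)))) = W (Rx φ (W x))) := by
  sorry

/-- **Registered stub `stub_circleClosed`** [M]. **A one-parameter group through a closed invariance group at an
irrational angle lies in it (provable now, M).** If `S` is continuous on `NonCoincident` and zero off
it, `T : ℝ → O(3)` is a one-parameter group (`T (φ+ψ) = T φ ∘ T ψ`, `φ ↦ T φ x` continuous,
`T (2π) = 1`), `θ₀/2π` is irrational and `S` is `T θ₀`-invariant, then `S` is `T φ`-invariant for
every `φ`. Proof sketch: `H := {φ | ∀ n x, S n (T φ ∘ x) = S n x}` is an additive subgroup of `ℝ`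
(`T 0 = 1` by the group law and injectivity; inverses via `T (−φ) ∘ T φ = 1`); it is CLOSED: for
`x ∈ NonCoincident`, `φ ↦ S n (T φ ∘ x)` is continuous (isometries preserve `NonCoincident`, `S n` is
continuous there), and off `NonCoincident` both sides vanish; `θ₀, 2π ∈ H`; by
`AddSubgroup.dense_or_cyclic` either `H` is dense (then `H = ℝ`, closed) or `H = ℤa`, and then
`θ₀ = ka`, `2π = ma` with `m ≠ 0` give `mθ₀ = k·2π`, contradicting irrationality. [folklore] -/
theorem stub_circleClosed :
  ∀ (S : CorrFamily 3) (T : ℝ → (E3 ≃ₗᵢ[ℝ] E3)) (θ₀ : ℝ),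
    (∀ n, ContinuousOn (S n) (NonCoincident 3 n)) →
    (∀ n z, z ∉ NonCoincident 3 n → S n z = 0) →
    (∀ φ ψ x, T (φ + ψ) x = T φ (T ψ x)) →
    (∀ x, Continuous fun φ => T φ x) →
    (∀ x, T (2 * Real.pi) x = x) →
    (∀ m k : ℤ, m ≠ 0 → (m : ℝ) * θ₀ ≠ (k : ℝ) * (2 * Real.pi)) →
    (∀ (n : ℕ) (x : Fin n → E3), S n (fun i => T θ₀ (x i)) = S n x) →
    ∀ (φ : ℝ) (n : ℕ) (x : Fin n → E3), S n (fun i => T φ (x i)) = S n x := by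
  sorry

/-- **Registered stub `stub_rotationsFromTwoCircles`** [M/L]. **Two conjugate coordinate circles and one coordinate reflection
give `O(3)` (provable now, M/L; pure group theory).** If the invariance group of a family `S` on `ℝ³`
contains, for some linear isometry `W` (a frame), the circle `{T | T (W x) = W (R_z(φ) x)}` over all
`φ`, the circle `{T | T (W x) = W (R_x(φ) x)}` over all `φ`, and the coordinate reflection
`x ↦ (−x₀, x₁, x₂)`, then `S` is `IsRotationInvariant` (all linear isometries, all orders, all
configurations). Proof sketch: `Γ := {T | ∀ n x, S n (T ∘ x) = S n x}` is a subgroup of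
`E3 ≃ₗᵢ[ℝ] E3`; it acts TRANSITIVELY on the unit sphere (for unit `u`, with `u' := W⁻¹ u`, some
`R_x(φ₁)` kills the third coordinate of `u'`, then some `R_z(φ₂)` turns it to `e₀`; so some `γ ∈ Γ`
maps `u` to `W e₀`); the coordinate reflection is `(ℝ ∙ e₀)ᗮ.reflection`, and
`γ ∘ (ℝ ∙ v)ᗮ.reflection ∘ γ⁻¹ = (ℝ ∙ γ v)ᗮ.reflection` (`Submodule.reflection_map`; a
`LinearIsometryEquiv` maps `(ℝ ∙ v)ᗮ` to `(ℝ ∙ γ v)ᗮ`), so `Γ` contains EVERY reflection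
`(ℝ ∙ v)ᗮ.reflection`; by Cartan–Dieudonné (`LinearIsometryEquiv.reflections_generate`) `Γ = ⊤`. [folklore] -/
theorem stub_rotationsFromTwoCircles :
  ∀ (Rz Rx : ℝ → E3 → E3),
    (∀ φ x, Rz φ x = WithLp.toLp 2
      ![Real.cos φ * x 0 - Real.sin φ * x 1, Real.sin φ * x 0 + Real.cos φ * x 1, x 2]) →
    (∀ φ x, Rx φ x = WithLp.toLp 2
      ![x 0, Real.cos φ * x 1 - Real.sin φ * x 2, Real.sin φ * x 1 + Real.cos φ * x 2]) →
    ∀ (S : CorrFamily 3) (W : E3 ≃ₗᵢ[ℝ] E3),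
    (∀ φ : ℝ, ∃ T : E3 ≃ₗᵢ[ℝ] E3, (∀ x, T (W x) = W (Rz φ x)) ∧
      ∀ (n : ℕ) (x : Fin n → E3), S n (fun i => T (x i)) = S n x) →
    (∀ φ : ℝ, ∃ T : E3 ≃ₗᵢ[ℝ] E3, (∀ x, T (W x) = W (Rx φ x)) ∧
      ∀ (n : ℕ) (x : Fin n → E3), S n (fun i => T (x i)) = S n x) →
    (∃ F : E3 ≃ₗᵢ[ℝ] E3, (∀ x, F x = WithLp.toLp 2 ![-x 0, x 1, x 2]) ∧
      ∀ (n : ℕ) (x : Fin n → E3), S n (fun i => F (x i)) = S n x) →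
    IsRotationInvariant S := by
  sorry

/-! ## §2 Composition — real proofs, no `sorry` below this line -/

/-! ### §2.1 Coordinates of explicit linear maps -/

/-- Coordinates of the real action of an integer matrix. [folklore] -/
theorem zlin_apply {d : ℕ} (M : Matrix (Fin d) (Fin d) ℤ) (v : EuclideanSpace ℝ (Fin d)) (j : Fin d) :
    zlin M v j = ∑ k, (M j k : ℝ) * v k := by
  simp [zlin, Matrix.toEuclideanLin, Matrix.toLpLin_apply, Matrix.mulVec, dotProduct]

/-- `M̃ (a,b,c) = (-b, a+b, c)`. [folklore] -/
theorem sixfold_apply (v : E3) : zlin sixfold v = WithLp.toLp 2 ![-(v 1), v 0 + v 1, v 2] := by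
  ext j
  rw [zlin_apply]
  fin_cases j <;> simp [sixfold, Fin.sum_univ_three]

/-- The real-linear map of a real `3 × 3` matrix on `ℝ³`. [folklore] -/
abbrev rlin (M : Matrix (Fin 3) (Fin 3) ℝ) : E3 →ₗ[ℝ] E3 := Matrix.toEuclideanLin M

/-- Coordinates of `rlin`. [folklore] -/
theorem rlin_apply (M : Matrix (Fin 3) (Fin 3) ℝ) (v : E3) (j : Fin 3) :
    rlin M v j = ∑ k, M j k * v k := by
  simp [rlin, Matrix.toEuclideanLin, Matrix.toLpLin_apply, Matrix.mulVec, dotProduct]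

/-- Squared norm on `ℝ³` in coordinates. [folklore] -/
theorem norm_sq_eq_three (v : E3) : ‖v‖ ^ 2 = v 0 ^ 2 + v 1 ^ 2 + v 2 ^ 2 := by
  rw [EuclideanSpace.norm_eq, Real.sq_sqrt (Finset.sum_nonneg fun i _ => sq_nonneg _)]
  simp [Fin.sum_univ_three, Real.norm_eq_abs, sq_abs]

/-- Two vectors of `ℝ³` with the same squared coordinates sum have the same norm. [folklore] -/
theorem norm_eq_of_sq {v w : E3} (h : v 0 ^ 2 + v 1 ^ 2 + v 2 ^ 2 = w 0 ^ 2 + w 1 ^ 2 + w 2 ^ 2) :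
    ‖v‖ = ‖w‖ := by
  have hv := norm_sq_eq_three v
  have hw := norm_sq_eq_three w
  have : ‖v‖ ^ 2 = ‖w‖ ^ 2 := by rw [hv, hw, h]
  exact (sq_eq_sq₀ (norm_nonneg _) (norm_nonneg _)).1 this

/-- Build a linear isometry of `ℝ³` from two mutually inverse linear maps, the first norm
preserving. [folklore] -/
def isoOfLinear (f g : E3 →ₗ[ℝ] E3) (h₁ : ∀ x, g (f x) = x) (h₂ : ∀ x, f (g x) = x)
    (hn : ∀ x, ‖f x‖ = ‖x‖) : E3 ≃ₗᵢ[ℝ] E3 :=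
  LinearIsometryEquiv.mk
    (LinearEquiv.ofLinear f g (LinearMap.ext h₂) (LinearMap.ext h₁) : E3 ≃ₗ[ℝ] E3) hn

/-- `isoOfLinear` acts as `f`. [folklore] -/
@[simp] theorem isoOfLinear_apply (f g : E3 →ₗ[ℝ] E3) (h₁ : ∀ x, g (f x) = x)
    (h₂ : ∀ x, f (g x) = x) (hn : ∀ x, ‖f x‖ = ‖x‖) (x : E3) :
    isoOfLinear f g h₁ h₂ hn x = f x := rfl

/-! ### §2.2 The explicit isometries: coordinate rotations, the frame `W`, the hex embedding -/

/-- Matrix of the rotation `R_z(φ)`. [folklore] -/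
def rotZMat (φ : ℝ) : Matrix (Fin 3) (Fin 3) ℝ :=
  !![Real.cos φ, -Real.sin φ, 0; Real.sin φ, Real.cos φ, 0; 0, 0, 1]

/-- Matrix of the rotation `R_x(φ)`. [folklore] -/
def rotXMat (φ : ℝ) : Matrix (Fin 3) (Fin 3) ℝ :=
  !![1, 0, 0; 0, Real.cos φ, -Real.sin φ; 0, Real.sin φ, Real.cos φ]

/-- `R_z(φ)` in coordinates. [folklore] -/
theorem rotZ_lin_apply (φ : ℝ) (v : E3) : rlin (rotZMat φ) v = WithLp.toLp 2
    ![Real.cos φ * v 0 - Real.sin φ * v 1, Real.sin φ * v 0 + Real.cos φ * v 1, v 2] := by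
  ext j; rw [rlin_apply]; fin_cases j <;> simp [rotZMat, Fin.sum_univ_three] <;> ring

/-- `R_x(φ)` in coordinates. [folklore] -/
theorem rotX_lin_apply (φ : ℝ) (v : E3) : rlin (rotXMat φ) v = WithLp.toLp 2
    ![v 0, Real.cos φ * v 1 - Real.sin φ * v 2, Real.sin φ * v 1 + Real.cos φ * v 2] := by
  ext j; rw [rlin_apply]; fin_cases j <;> simp [rotXMat, Fin.sum_univ_three] <;> ring

/-- The rotation `R_z(φ)` as a linear isometry of `ℝ³`. [folklore] -/
def rotZ (φ : ℝ) : E3 ≃ₗᵢ[ℝ] E3 :=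
  isoOfLinear (rlin (rotZMat φ)) (rlin (rotZMat (-φ)))
    (by
      intro x
      have hc := Real.cos_sq_add_sin_sq φ
      rw [rotZ_lin_apply, rotZ_lin_apply]
      ext j; fin_cases j
      · simp [Real.cos_neg, Real.sin_neg]; linear_combination (x 0) * hc
      · simp [Real.cos_neg, Real.sin_neg]; linear_combination (x 1) * hc
      · simp)
    (by
      intro x
      have hc := Real.cos_sq_add_sin_sq φ
      rw [rotZ_lin_apply, rotZ_lin_apply]
      ext j; fin_cases j
      · simp [Real.cos_neg, Real.sin_neg]; linear_combination (x 0) * hc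
      · simp [Real.cos_neg, Real.sin_neg]; linear_combination (x 1) * hc
      · simp)
    (by
      intro x
      apply norm_eq_of_sq
      rw [rotZ_lin_apply]
      simp
      linear_combination (x 0 ^ 2 + x 1 ^ 2) * Real.cos_sq_add_sin_sq φ)

/-- `R_z(φ)` in coordinates. [folklore] -/
theorem rotZ_apply (φ : ℝ) (v : E3) : rotZ φ v = WithLp.toLp 2
    ![Real.cos φ * v 0 - Real.sin φ * v 1, Real.sin φ * v 0 + Real.cos φ * v 1, v 2] := by
  rw [rotZ, isoOfLinear_apply, rotZ_lin_apply]

/-- The rotation `R_x(φ)` as a linear isometry of `ℝ³`. [folklore] -/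
def rotX (φ : ℝ) : E3 ≃ₗᵢ[ℝ] E3 :=
  isoOfLinear (rlin (rotXMat φ)) (rlin (rotXMat (-φ)))
    (by
      intro x
      have hc := Real.cos_sq_add_sin_sq φ
      rw [rotX_lin_apply, rotX_lin_apply]
      ext j; fin_cases j
      · simp
      · simp [Real.cos_neg, Real.sin_neg]; linear_combination (x 1) * hc
      · simp [Real.cos_neg, Real.sin_neg]; linear_combination (x 2) * hc)
    (by
      intro x
      have hc := Real.cos_sq_add_sin_sq φ
      rw [rotX_lin_apply, rotX_lin_apply]
      ext j; fin_cases j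
      · simp
      · simp [Real.cos_neg, Real.sin_neg]; linear_combination (x 1) * hc
      · simp [Real.cos_neg, Real.sin_neg]; linear_combination (x 2) * hc)
    (by
      intro x
      apply norm_eq_of_sq
      rw [rotX_lin_apply]
      simp
      linear_combination (x 1 ^ 2 + x 2 ^ 2) * Real.cos_sq_add_sin_sq φ)

/-- `R_x(φ)` in coordinates. [folklore] -/
theorem rotX_apply (φ : ℝ) (v : E3) : rotX φ v = WithLp.toLp 2
    ![v 0, Real.cos φ * v 1 - Real.sin φ * v 2, Real.sin φ * v 1 + Real.cos φ * v 2] := by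
  rw [rotX, isoOfLinear_apply, rotX_lin_apply]

/-- Matrix of the symmetric orthogonal frame `W` (`W e₀ = (-1,0,2)/√5`, `W e₁ = -e₁`,
`W e₂ = (2,0,1)/√5`, `W² = 1`). [folklore] -/
def frameWMat : Matrix (Fin 3) (Fin 3) ℝ :=
  !![-1 / Real.sqrt 5, 0, 2 / Real.sqrt 5; 0, -1, 0; 2 / Real.sqrt 5, 0, 1 / Real.sqrt 5]

/-- `W` in coordinates. [folklore] -/
theorem frameW_lin_apply (v : E3) : rlin frameWMat v = WithLp.toLp 2
    ![(-v 0 + 2 * v 2) / Real.sqrt 5, -v 1, (2 * v 0 + v 2) / Real.sqrt 5] := by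
  ext j; rw [rlin_apply]; fin_cases j <;> simp [frameWMat, Fin.sum_univ_three] <;> ring

/-- `√5 ≠ 0` and `(√5)² = 5`. [folklore] -/
theorem sqrt5_facts : Real.sqrt 5 ≠ 0 ∧ Real.sqrt 5 ^ 2 = 5 :=
  ⟨by positivity, Real.sq_sqrt (by norm_num)⟩

/-- `W (W v) = v`. [folklore] -/
theorem frameW_lin_involutive (v : E3) : rlin frameWMat (rlin frameWMat v) = v := by
  obtain ⟨h0, h5⟩ := sqrt5_facts
  rw [frameW_lin_apply, frameW_lin_apply]
  ext j; fin_cases j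
  · simp; field_simp
    first
    | linear_combination (v 0) * h5
    | linear_combination (-(v 0)) * h5
    | linear_combination (2 * v 0) * h5
    | linear_combination (-2 * v 0) * h5
  · simp
  · simp; field_simp
    first
    | linear_combination (v 2) * h5
    | linear_combination (v 0) * h5
    | linear_combination (v 0 + v 2) * h5
    | linear_combination (-(v 0 + v 2)) * h5
    | linear_combination (-(v 2)) * h5

/-- The frame `W` as a linear isometry of `ℝ³`. [folklore] -/
def frameW : E3 ≃ₗᵢ[ℝ] E3 :=
  isoOfLinear (rlin frameWMat) (rlin frameWMat) frameW_lin_involutive frameW_lin_involutive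
    (by
      intro x
      obtain ⟨h0, h5⟩ := sqrt5_facts
      apply norm_eq_of_sq
      rw [frameW_lin_apply]
      simp
      field_simp
      first
      | linear_combination (-(x 0 ^ 2 + x 2 ^ 2)) * h5
      | linear_combination (x 0 ^ 2 + x 2 ^ 2) * h5
      | linear_combination (5 * (x 0 ^ 2 + x 1 ^ 2 + x 2 ^ 2)) * h5
      | linear_combination (-(5 * (x 0 ^ 2 + x 1 ^ 2 + x 2 ^ 2))) * h5
      | linear_combination (-(6 * x 0 ^ 2 + 6 * x 2 ^ 2 + 5 * x 1 ^ 2)) * h5)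

/-- `W` in coordinates. [folklore] -/
theorem frameW_apply (v : E3) : frameW v = WithLp.toLp 2
    ![(-v 0 + 2 * v 2) / Real.sqrt 5, -v 1, (2 * v 0 + v 2) / Real.sqrt 5] := by
  rw [frameW, isoOfLinear_apply, frameW_lin_apply]

/-- `W (W v) = v`. [folklore] -/
theorem frameW_frameW (v : E3) : frameW (frameW v) = v := by
  rw [frameW, isoOfLinear_apply, isoOfLinear_apply, frameW_lin_involutive]

/-- The diagonal sign map `x ↦ (ε₀x₀, ε₁x₁, ε₂x₂)` as a linear map. [folklore] -/
def flipLin (ε : Fin 3 → ℤˣ) : E3 →ₗ[ℝ] E3 := rlin (Matrix.diagonal fun j => ((ε j : ℤ) : ℝ))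

/-- Coordinates of `flipLin`. [folklore] -/
theorem flipLin_apply (ε : Fin 3 → ℤˣ) (x : E3) (j : Fin 3) :
    flipLin ε x j = ((ε j : ℤ) : ℝ) * x j := by
  rw [flipLin, rlin_apply, Fin.sum_univ_three]
  fin_cases j <;> simp [Matrix.diagonal_apply]

/-- `ε_j² = 1` in `ℝ`. [folklore] -/
theorem units_cast_mul_self (u : ℤˣ) : ((u : ℤ) : ℝ) * ((u : ℤ) : ℝ) = 1 := by
  rcases Int.units_eq_one_or u with h | h <;> simp [h]

/-- The signed coordinate isometries of `ℝ³` used below, as ONE constructor: `x ↦ (ε₀ x_{π 0},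
ε₁ x_{π 1}, ε₂ x_{π 2})`. [folklore] -/
def signedIso (π : Equiv.Perm (Fin 3)) (ε : Fin 3 → ℤˣ) : E3 ≃ₗᵢ[ℝ] E3 :=
  (LinearIsometryEquiv.piLpCongrLeft 2 ℝ ℝ π.symm).trans
    (isoOfLinear (flipLin ε) (flipLin ε)
      (by
        intro x; ext j
        rw [flipLin_apply, flipLin_apply, ← mul_assoc, units_cast_mul_self, one_mul])
      (by
        intro x; ext j
        rw [flipLin_apply, flipLin_apply, ← mul_assoc, units_cast_mul_self, one_mul])
      (by
        intro x
        apply norm_eq_of_sq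
        have hsq : ∀ j : Fin 3, (((ε j : ℤ) : ℝ) * x j) ^ 2 = x j ^ 2 := fun j => by
          rcases Int.units_eq_one_or (ε j) with h | h <;> simp [h]
        rw [flipLin_apply, flipLin_apply, flipLin_apply, hsq, hsq, hsq]))

/-- Coordinates of `signedIso`. [folklore] -/
theorem signedIso_apply (π : Equiv.Perm (Fin 3)) (ε : Fin 3 → ℤˣ) (x : E3) (j : Fin 3) :
    signedIso π ε x j = ((ε j : ℤ) : ℝ) * x (π j) := by
  simp only [signedIso, LinearIsometryEquiv.trans_apply, isoOfLinear_apply]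
  rw [flipLin_apply, MoebiusLimitExistsNegative.coordPerm_apply]
  simp

/-! ### §2.3 Invariance bookkeeping -/

section Invariance

variable {S : CorrFamily 3}

/-- The invariance predicate. [folklore] -/
def Inv (S : CorrFamily 3) (T : E3 → E3) : Prop := ∀ (n : ℕ) (x : Fin n → E3), S n (fun i => T (x i)) = S n x

/-- Invariances compose. [folklore] -/
theorem Inv.comp {A B : E3 → E3} (hA : Inv S A) (hB : Inv S B) : Inv S (fun x => A (B x)) := by
  intro n x
  rw [show (fun i => A (B (x i))) = fun i => A ((fun i => B (x i)) i) from rfl, hA, hB]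

/-- Invariance passes to the inverse of an isometry. [folklore] -/
theorem Inv.symm {R : E3 ≃ₗᵢ[ℝ] E3} (hR : Inv S R) : Inv S R.symm := by
  intro n x
  have := hR n (fun i => R.symm (x i))
  simpa using this.symm

/-- Invariance is extensional. [folklore] -/
theorem Inv.congr {A B : E3 → E3} (hA : Inv S A) (h : ∀ x, A x = B x) : Inv S B := by
  intro n x
  have := hA n x
  simpa [h] using this

/-- `B₃` generators give every `signedIso`. [folklore] -/
theorem inv_signedIso
    (hperm : ∀ (π : Equiv.Perm (Fin 3)) (n : ℕ) (x : Fin n → E3),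
      S n (fun i => LinearIsometryEquiv.piLpCongrLeft 2 ℝ ℝ π (x i)) = S n x)
    (hflip : ∀ (ε : Fin 3 → ℤˣ) (R : E3 ≃ₗᵢ[ℝ] E3), (∀ (p : E3) (j : Fin 3), R p j = ((ε j : ℤ) : ℝ) * p j) →
      ∀ (n : ℕ) (x : Fin n → E3), S n (fun i => R (x i)) = S n x)
    (π : Equiv.Perm (Fin 3)) (ε : Fin 3 → ℤˣ) : Inv S (signedIso π ε) := by
  have h1 : Inv S (LinearIsometryEquiv.piLpCongrLeft 2 ℝ ℝ π.symm) := fun n x => hperm π.symm n x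
  have h2 : Inv S (signedIso 1 ε) := by
    refine hflip ε (signedIso 1 ε) fun p j => ?_
    rw [signedIso_apply]; simp
  refine (h2.comp h1).congr fun x => ?_
  ext j
  rw [signedIso_apply, signedIso_apply]
  simp [MoebiusLimitExistsNegative.coordPerm_apply]

end Invariance

/-! ### §2.4 The explicit elements of the invariance group -/

/-- `R_z(-90°) : (x₀,x₁,x₂) ↦ (x₁, -x₀, x₂)` as a signed coordinate isometry. [folklore] -/
def rzNeg90 : E3 ≃ₗᵢ[ℝ] E3 := signedIso (Equiv.swap 0 1) ![1, -1, 1]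

/-- `R_x(90°) : (x₀,x₁,x₂) ↦ (x₀, -x₂, x₁)`. [folklore] -/
def rx90 : E3 ≃ₗᵢ[ℝ] E3 := signedIso (Equiv.swap 1 2) ![1, -1, 1]

/-- `R_c : (x₀,x₁,x₂) ↦ (-x₂, x₁, x₀)`. [folklore] -/
def rc : E3 ≃ₗᵢ[ℝ] E3 := signedIso (Equiv.swap 0 2) ![-1, 1, 1]

/-- The coordinate reflection `(x₀,x₁,x₂) ↦ (-x₀, x₁, x₂)`. [folklore] -/
def flip0 : E3 ≃ₗᵢ[ℝ] E3 := signedIso 1 ![-1, 1, 1]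

/-- `R_z(-90°)` in coordinates. [folklore] -/
theorem rzNeg90_apply (x : E3) : rzNeg90 x = WithLp.toLp 2 ![x 1, -x 0, x 2] := by
  ext j; fin_cases j <;> simp [rzNeg90, signedIso_apply, Equiv.swap_apply_of_ne_of_ne]

/-- `R_x(90°)` in coordinates. [folklore] -/
theorem rx90_apply (x : E3) : rx90 x = WithLp.toLp 2 ![x 0, -x 2, x 1] := by
  ext j; fin_cases j <;> simp [rx90, signedIso_apply, Equiv.swap_apply_of_ne_of_ne]

/-- `R_c` in coordinates. [folklore] -/
theorem rc_apply (x : E3) : rc x = WithLp.toLp 2 ![-x 2, x 1, x 0] := by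
  ext j; fin_cases j <;> simp [rc, signedIso_apply, Equiv.swap_apply_of_ne_of_ne]

/-- `R_c⁻¹` in coordinates. [folklore] -/
theorem rc_symm_apply (x : E3) : rc.symm x = WithLp.toLp 2 ![x 2, x 1, -x 0] := by
  apply rc.injective
  rw [LinearIsometryEquiv.apply_symm_apply, rc_apply]
  ext j; fin_cases j <;> simp

/-- The coordinate reflection in coordinates. [folklore] -/
theorem flip0_apply (x : E3) : flip0 x = WithLp.toLp 2 ![-x 0, x 1, x 2] := by
  ext j; fin_cases j <;> simp [flip0, signedIso_apply]

/-- `R_z(60°)`: the transported sixfold map in the symmetric gauge. [folklore] -/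
def rz60 : E3 ≃ₗᵢ[ℝ] E3 := rotZ (Real.pi / 3)

/-- `R_z(60°)` in coordinates. [folklore] -/
theorem rz60_apply (x : E3) :
    rz60 x = WithLp.toLp 2 ![x 0 / 2 - Real.sqrt 3 / 2 * x 1, Real.sqrt 3 / 2 * x 0 + x 1 / 2, x 2] := by
  rw [rz60, rotZ_apply, Real.cos_pi_div_three, Real.sin_pi_div_three]
  ext j; fin_cases j <;> simp <;> ring

/-- `R_z(30°) = R_z(60°) ∘ R_z(60°) ∘ R_z(-90°)` in coordinates. [folklore] -/
theorem rz30_apply (x : E3) : rz60 (rz60 (rzNeg90 x)) =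
    WithLp.toLp 2 ![Real.sqrt 3 / 2 * x 0 - x 1 / 2, x 0 / 2 + Real.sqrt 3 / 2 * x 1, x 2] := by
  have h3 : Real.sqrt 3 ^ 2 = 3 := Real.sq_sqrt (by norm_num)
  rw [rzNeg90_apply, rz60_apply, rz60_apply]
  ext j; fin_cases j
  · simp
    first
    | ring1
    | linear_combination (-(1:ℝ) / 4 * x 1) * h3
    | linear_combination ((1:ℝ) / 4 * x 1) * h3
    | linear_combination (-(1:ℝ) / 2 * x 1) * h3
    | linear_combination ((x 0 - x 1) / 4) * h3
    | linear_combination ((x 1 - x 0) / 4) * h3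
    | linear_combination ((1:ℝ) / 2 * x 1) * h3
  · simp
    first
    | ring1
    | linear_combination ((1:ℝ) / 4 * x 0) * h3
    | linear_combination (-(1:ℝ) / 4 * x 0) * h3
    | linear_combination (-(1:ℝ) / 2 * x 1) * h3
    | linear_combination ((x 0 - x 1) / 4) * h3
    | linear_combination ((x 1 - x 0) / 4) * h3
    | linear_combination ((1:ℝ) / 2 * x 1) * h3
    | linear_combination ((1:ℝ) / 2 * x 0) * h3
    | linear_combination (-(1:ℝ) / 2 * x 0) * h3
    | linear_combination ((x 0 + x 1) / 4) * h3
    | linear_combination (-(x 0 + x 1) / 4) * h3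
  · simp

/-- The one-parameter group `T φ := W R_z(φ) W`. [folklore] -/
def circleZ (φ : ℝ) : E3 ≃ₗᵢ[ℝ] E3 := (frameW.trans (rotZ φ)).trans frameW

/-- The conjugate one-parameter group `T' φ := W R_x(φ) W`. [folklore] -/
def circleX (φ : ℝ) : E3 ≃ₗᵢ[ℝ] E3 := (frameW.trans (rotX φ)).trans frameW

/-- `T φ x = W (R_z(φ) (W x))`. [folklore] -/
theorem circleZ_apply (φ : ℝ) (x : E3) : circleZ φ x = frameW (rotZ φ (frameW x)) := rfl

/-- `T' φ x = W (R_x(φ) (W x))`. [folklore] -/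
theorem circleX_apply (φ : ℝ) (x : E3) : circleX φ x = frameW (rotX φ (frameW x)) := rfl

/-- Group law of `R_z`. [folklore] -/
theorem rotZ_add (φ ψ : ℝ) (x : E3) : rotZ (φ + ψ) x = rotZ φ (rotZ ψ x) := by
  rw [rotZ_apply, rotZ_apply, rotZ_apply, Real.cos_add, Real.sin_add]
  ext j; fin_cases j <;> simp <;> ring

/-- Group law of `T`. [folklore] -/
theorem circleZ_add (φ ψ : ℝ) (x : E3) : circleZ (φ + ψ) x = circleZ φ (circleZ ψ x) := by
  simp only [circleZ_apply, frameW_frameW, rotZ_add]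

/-- `T (2π) = 1`. [folklore] -/
theorem circleZ_two_pi (x : E3) : circleZ (2 * Real.pi) x = x := by
  rw [circleZ_apply, rotZ_apply, Real.cos_two_pi, Real.sin_two_pi]
  have : (WithLp.toLp 2 ![1 * frameW x 0 - 0 * frameW x 1, 0 * frameW x 0 + 1 * frameW x 1,
      frameW x 2] : E3) = frameW x := by
    ext j; fin_cases j <;> simp
  rw [this, frameW_frameW]

/-- Continuity of `φ ↦ T φ x`. [folklore] -/
theorem continuous_circleZ (x : E3) : Continuous fun φ => circleZ φ x := by
  have h : Continuous fun φ : ℝ => rotZ φ (frameW x) := by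
    have : (fun φ : ℝ => rotZ φ (frameW x)) = fun φ => WithLp.toLp 2
        ![Real.cos φ * frameW x 0 - Real.sin φ * frameW x 1,
          Real.sin φ * frameW x 0 + Real.cos φ * frameW x 1, frameW x 2] := by
      funext φ; exact rotZ_apply φ _
    rw [this]
    refine (PiLp.continuous_toLp 2 (fun _ : Fin 3 => ℝ)).comp ?_
    refine continuous_pi fun j => ?_
    fin_cases j <;> simp <;> fun_prop
  simp only [circleZ_apply]
  exact frameW.continuous.comp h

/-! ### §2.5 The hex embedding `L_c` -/

/-- Matrix of the symmetric-gauge embedding `L_c`. [folklore] -/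
def hexMat (c : ℝ) : Matrix (Fin 3) (Fin 3) ℝ := !![1, 1 / 2, 0; 0, Real.sqrt 3 / 2, 0; 0, 0, c]

/-- Matrix of `L_c⁻¹`. [folklore] -/
def hexInvMat (c : ℝ) : Matrix (Fin 3) (Fin 3) ℝ :=
  !![1, -1 / Real.sqrt 3, 0; 0, 2 / Real.sqrt 3, 0; 0, 0, 1 / c]

/-- `L_c` in coordinates. [folklore] -/
theorem hex_lin_apply (c : ℝ) (v : E3) : rlin (hexMat c) v =
    WithLp.toLp 2 ![v 0 + v 1 / 2, Real.sqrt 3 / 2 * v 1, c * v 2] := by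
  ext j; rw [rlin_apply]; fin_cases j <;> simp [hexMat, Fin.sum_univ_three] <;> ring

/-- `L_c⁻¹` in coordinates. [folklore] -/
theorem hexInv_lin_apply (c : ℝ) (v : E3) : rlin (hexInvMat c) v =
    WithLp.toLp 2 ![v 0 - v 1 / Real.sqrt 3, 2 / Real.sqrt 3 * v 1, v 2 / c] := by
  ext j; rw [rlin_apply]; fin_cases j <;> simp [hexInvMat, Fin.sum_univ_three] <;> ring

/-- `√3 ≠ 0` and `(√3)² = 3`. [folklore] -/
theorem sqrt3_facts : Real.sqrt 3 ≠ 0 ∧ Real.sqrt 3 ^ 2 = 3 :=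
  ⟨by positivity, Real.sq_sqrt (by norm_num)⟩

/-- `L_c` as a continuous linear automorphism of `ℝ³` (`c ≠ 0`). [folklore] -/
def hexEmbed (c : ℝ) (hc : c ≠ 0) : E3 ≃L[ℝ] E3 :=
  LinearEquiv.toContinuousLinearEquiv
    (LinearEquiv.ofLinear (rlin (hexMat c)) (rlin (hexInvMat c))
      (by
        apply LinearMap.ext; intro v
        obtain ⟨h0, h3⟩ := sqrt3_facts
        simp only [LinearMap.comp_apply, LinearMap.id_apply]
        rw [hexInv_lin_apply, hex_lin_apply]
        ext j; fin_cases j <;> simp <;> field_simp <;>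
          first
          | ring1
          | linear_combination (-(1:ℝ) / 2 * v 1) * h3
          | linear_combination ((1:ℝ) / 2 * v 1) * h3
          | linear_combination ((3:ℝ) / 2 * v 1) * h3
          | linear_combination (-(3:ℝ) / 2 * v 1) * h3
          | linear_combination (v 1) * h3
          | linear_combination (-(v 1)) * h3)
      (by
        apply LinearMap.ext; intro v
        obtain ⟨h0, h3⟩ := sqrt3_facts
        simp only [LinearMap.comp_apply, LinearMap.id_apply]
        rw [hex_lin_apply, hexInv_lin_apply]
        ext j; fin_cases j <;> simp <;> field_simp <;>
          first
          | ring1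
          | linear_combination (-(1:ℝ) / 2 * v 1) * h3
          | linear_combination ((1:ℝ) / 2 * v 1) * h3
          | linear_combination ((3:ℝ) / 2 * v 1) * h3
          | linear_combination (-(3:ℝ) / 2 * v 1) * h3
          | linear_combination (v 1) * h3
          | linear_combination (-(v 1)) * h3))

/-- `L_c` in coordinates. [folklore] -/
theorem hexEmbed_apply (c : ℝ) (hc : c ≠ 0) (v : E3) :
    hexEmbed c hc v = WithLp.toLp 2 ![v 0 + v 1 / 2, Real.sqrt 3 / 2 * v 1, c * v 2] := by
  show rlin (hexMat c) v = _
  exact hex_lin_apply c v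

/-- `L_c⁻¹` in coordinates. [folklore] -/
theorem hexEmbed_symm_apply (c : ℝ) (hc : c ≠ 0) (v : E3) :
    (hexEmbed c hc).symm v = WithLp.toLp 2 ![v 0 - v 1 / Real.sqrt 3, 2 / Real.sqrt 3 * v 1, v 2 / c] := by
  show rlin (hexInvMat c) v = _
  exact hexInv_lin_apply c v

/-- **The transported sixfold map is `R_z(60°)` on the nose**: `L_c M̃ L_c⁻¹ = R_z(60°)`. [folklore] -/
theorem hexEmbed_conj_sixfold (c : ℝ) (hc : c ≠ 0) (x : E3) :
    hexEmbed c hc (zlin sixfold ((hexEmbed c hc).symm x)) = rz60 x := by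
  obtain ⟨h0, h3⟩ := sqrt3_facts
  rw [hexEmbed_symm_apply, sixfold_apply, hexEmbed_apply, rz60_apply]
  ext j; fin_cases j <;> simp <;> field_simp <;>
    first
    | ring1
    | linear_combination (-(1:ℝ) / 2 * x 1) * h3
    | linear_combination ((1:ℝ) / 2 * x 1) * h3
    | linear_combination ((3:ℝ) / 2 * x 1) * h3
    | linear_combination (-(3:ℝ) / 2 * x 1) * h3
    | linear_combination (-(1:ℝ) * x 1) * h3
    | linear_combination ((1:ℝ) * x 1) * h3
    | linear_combination (-(1:ℝ) / 2 * x 0) * h3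
    | linear_combination ((1:ℝ) / 2 * x 0) * h3
    | linear_combination (x 0) * h3
    | linear_combination (-(x 0)) * h3

/-! ### §2.6 The composition -/

/-- **Composition (the skeleton theorem).** The crux `RotationUpgradeFromTwoPoint`, concluded BY
NAME, from the seven registered stubs. Hypotheses (H4)–(H7) are not used (the symmetric gauge makes
the transported sixfold map an isometry without appeal to the two-point function). -/
theorem RotationUpgradeFromTwoPoint_of : Theses.GaussianScaleMixture.RotationUpgradeFromTwoPoint := by
  intro ρ Δ S h1 h2 h3 h4 _h5 _h6 _h7
  -- free structure of any limit of `criticalCorr 3`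
  have hcont : ∀ n, ContinuousOn (S n) (NonCoincident 3 n) := fun n =>
    LimitMeshContinuity.continuousOn_limit h2 n
  have hperm : ∀ (π : Equiv.Perm (Fin 3)) (n : ℕ) (x : Fin n → E3),
      S n (fun i => LinearIsometryEquiv.piLpCongrLeft 2 ℝ ℝ π (x i)) = S n x := by
    intro π n x
    by_cases hx : x ∈ NonCoincident 3 n
    · exact MoebiusLimitExistsNegative.limit_coordPerm h2 π hx
    · rw [h3 n x hx,
        h3 n _ (mt (MoebiusLimitExistsNegative.map_mem_nonCoincident_iff _ x).1 hx)]
  have hflip : ∀ (ε : Fin 3 → ℤˣ) (R : E3 ≃ₗᵢ[ℝ] E3),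
      (∀ (p : E3) (j : Fin 3), R p j = ((ε j : ℤ) : ℝ) * p j) →
      ∀ (n : ℕ) (x : Fin n → E3), S n (fun i => R (x i)) = S n x := by
    intro ε R hR n x
    by_cases hx : x ∈ NonCoincident 3 n
    · exact MoebiusLimitExistsNegative.limit_signFlip h2 ε R hR hx
    · rw [h3 n x hx,
        h3 n _ (mt (MoebiusLimitExistsNegative.map_mem_nonCoincident_iff R x).1 hx)]
  have hsigned : ∀ π ε, Inv S (signedIso π ε) := inv_signedIso hperm hflip
  -- stub 1: the bridge, symmetric gauge
  obtain ⟨ρ', c, _hρ', hc, hlim'⟩ := stub_hexStackUniversality ρ S h1 h2 h3 h4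
  have hc0 : c ≠ 0 := hc.ne'
  set L := hexEmbed c hc0 with hL
  set S' : CorrFamily 3 := fun n x => S n (fun i => L (x i)) with hS'
  have hlimL : HasPointwiseScalingLimit stCriticalCorr ρ' S' := by
    have : S' = fun n x => S n (fun i => WithLp.toLp 2
        ![(x i) 0 + (x i) 1 / 2, Real.sqrt 3 / 2 * (x i) 1, c * (x i) 2]) := by
      funext n x
      simp only [hS', hL, hexEmbed_apply]
    rw [this]; exact hlim'
  have hmapL : ∀ (n : ℕ) (x : Fin n → E3),
      (fun i => L (x i)) ∈ NonCoincident 3 n ↔ x ∈ NonCoincident 3 n := by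
    intro n x
    rw [mem_nonCoincident, mem_nonCoincident]
    exact L.injective.of_comp_iff x
  have hcont' : ∀ n, ContinuousOn (S' n) (NonCoincident 3 n) := by
    intro n
    have hΦ : Continuous (fun (x : Fin n → E3) (i : Fin n) => L (x i)) :=
      continuous_pi fun i => L.continuous.comp (continuous_apply i)
    exact (hcont n).comp hΦ.continuousOn (fun x hx => (hmapL n x).2 hx)
  -- stub 2: the `T`-correlators are exactly `M̃`-invariant
  have hGsix : ∀ (n : ℕ) (k : Fin n → Site 3),
      stCriticalCorr n (fun i => sixfold.mulVec (k i)) = stCriticalCorr n k := by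
    intro n k
    exact stub_hexPlusStateSixfold stGraph stGraph_adj_iff_bond stCriticalBeta stCriticalBeta_nonneg n k
  -- stub 3: transport to the limit
  have hsix : ∀ (n : ℕ) (x : Fin n → E3), x ∈ NonCoincident 3 n →
      S' n (fun i => zlin sixfold (x i)) = S' n x :=
    stub_latticeSymmetryTransport 3 stCriticalCorr ρ' S' sixfold sixfoldInv sixfold_mul_sixfoldInv
      sixfoldInv_mul_sixfold hGsix hlimL hcont'
  -- hence `S` is invariant under `R_z(60°) = L M̃ L⁻¹` everywhere
  have hrz60 : Inv S rz60 := by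
    intro n x
    by_cases hx : x ∈ NonCoincident 3 n
    · have hy : (fun i => L.symm (x i)) ∈ NonCoincident 3 n := by
        rw [mem_nonCoincident] at hx ⊢
        exact L.symm.injective.comp hx
      have key := hsix n (fun i => L.symm (x i)) hy
      simp only [hS'] at key
      simp only [ContinuousLinearEquiv.apply_symm_apply] at key
      have hcfg : (fun i => L (zlin sixfold (L.symm (x i)))) = fun i => rz60 (x i) := by
        funext i; exact hexEmbed_conj_sixfold c hc0 (x i)
      rw [hcfg] at key
      exact key
    · rw [h3 n x hx, h3 n _ (mt (MoebiusLimitExistsNegative.map_mem_nonCoincident_iff rz60 x).1 hx)]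
  -- the explicit element `N = R_z(30°) R_x(90°) R_z(30°)` and the circle `T φ = W R_z(φ) W`
  have hrz30 : Inv S (fun x => rz60 (rz60 (rzNeg90 x))) :=
    (hrz60.comp hrz60).comp (hsigned _ _)
  have hN : Inv S (fun x => rz60 (rz60 (rzNeg90 (rx90 (rz60 (rz60 (rzNeg90 x))))))) :=
    (hrz30.comp (hsigned _ _)).comp hrz30
  obtain ⟨htw1, htw2⟩ := stub_twistIdentities frameW (fun x => rz60 (rz60 (rzNeg90 x))) rx90
    (rotZ (Real.arccos (-1 / 4))) rc rc.symm (fun φ x => rotZ φ x) (fun φ x => rotX φ x)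
    frameW_apply rz30_apply rx90_apply
    (by
      intro x
      rw [rotZ_apply, Real.cos_arccos (by norm_num) (by norm_num), Real.sin_arccos]
      have : Real.sqrt (1 - (-1 / 4) ^ 2) = Real.sqrt 15 / 4 := by
        rw [show (1 : ℝ) - (-1 / 4) ^ 2 = 15 / 16 by norm_num, Real.sqrt_div' _ (by norm_num : (0:ℝ) ≤ 16)]
        rw [show (16 : ℝ) = 4 ^ 2 by norm_num, Real.sqrt_sq (by norm_num)]
      rw [this]
      ext j; fin_cases j <;> simp <;> ring)
    rc_apply rc_symm_apply rotZ_apply rotX_apply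
  have hTθ₀ : Inv S (circleZ (Real.arccos (-1 / 4))) := by
    refine hN.congr fun x => ?_
    rw [circleZ_apply, htw1 x]
  -- stub 6: the whole circle
  have hcircZ : ∀ φ, Inv S (circleZ φ) := by
    intro φ n x
    exact stub_circleClosed S circleZ (Real.arccos (-1 / 4)) hcont h3 circleZ_add continuous_circleZ
      circleZ_two_pi stub_arccosQuarter hTθ₀ φ n x
  -- the conjugate circle `W R_x(φ) W = R_c (W R_z(φ) W) R_c⁻¹`
  have hcircX : ∀ φ, Inv S (circleX φ) := by
    intro φ
    have h := ((hsigned (Equiv.swap 0 2) ![-1, 1, 1]).comp (hcircZ φ)).comp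
      (hsigned (Equiv.swap 0 2) ![-1, 1, 1]).symm
    refine h.congr fun x => ?_
    show rc (circleZ φ (rc.symm x)) = circleX φ x
    rw [circleZ_apply, circleX_apply]
    exact htw2 φ x
  -- stub 7: two circles + one reflection ⇒ O(3)
  refine stub_rotationsFromTwoCircles (fun φ x => rotZ φ x) (fun φ x => rotX φ x) rotZ_apply rotX_apply
    S frameW ?_ ?_ ?_
  · intro φ
    refine ⟨circleZ φ, fun x => ?_, hcircZ φ⟩
    rw [circleZ_apply, frameW_frameW]
  · intro φ
    refine ⟨circleX φ, fun x => ?_, hcircX φ⟩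
    rw [circleX_apply, frameW_frameW]
  · exact ⟨flip0, flip0_apply, hsigned 1 ![-1, 1, 1]⟩

end Summit.CriticalPhenomena.Ising3DConformalLimit.Cruxes.RotationUpgradeFromTwoPoint.TwoCrystalsGenerateSo3

end
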